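import Summits.AtomisticToContinuum.Crystallization.Theses.PalmUnimodularRigidity
import Summits.AtomisticToContinuum.Crystallization.Theorems.MinimiserShells.Negative.LoadBearing
import Summits.AtomisticToContinuum.Crystallization.Theorems.MinimiserShells.Negative.Rootedness
import Summits.AtomisticToContinuum.Crystallization.Theorems.ChargedEnergyGap.Negative.Unconditional
import Summits.AtomisticToContinuum.Crystallization.Theorems.PalmUnimodularRigidityMinimiserShellsEquilibriumInLawShells
import Summits.AtomisticToContinuum.Crystallization.Theorems.PalmUnimodularRigidityMinimiserShellsEquilibriumInLawCluster
import Literature.Probability.Process.PointStationaryLaw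
import Literature.MathematicalPhysics.StatisticalMechanics.RootEnergy
import Literature.MathematicalPhysics.StatisticalMechanics.MuGSC

/-!
# Multi-site cluster repair: gaining local modifications force an energy excess

Helper file for stub `stub_equilibriumInLaw` (S1) of line `equilibrium-in-law-surgery`, crux
`MinimiserShells` (stmt-AtomisticToContinuum-9225): blueprint lemma 6 (the ★ lemma of the
grid-free half).

**`le_half_sum_sum_of_repairSites`.**  Let `S ⊆ ℝ³` be `δ`-separated and `C ⊆ S` finite.  Suppose
`m` "repair sites" are given: centres `y_j` pairwise `≥ D` apart, each `R₀`-deep in `C`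
(`S ∩ B̄(y_j, R₀) ⊆ C`), and at each a finite modification "remove the distinct points `xf_j` of
`S ∩ B̄(y_j, r)`, insert the distinct points `R_j ⊆ B̄(y_j, r)` off `S ∖ xf_j`" that GAINS at
least `ε` in Sütő's functional at chemical potential `e*`:
`U(R_j) + I(R_j, S ∖ xf_j) − e* k + ε ≤ U(xf_j) + I(xf_j, S ∖ xf_j) − e* n₀`.  If the cross
terms and tails are small (`4000 (n₀+k)² D⁻⁶ ≤ ε/2`, `500 (n₀+k) δ⁻⁴ (R₀−r)⁻² ≤ ε/2`,
`D ≥ 4r + max 1 δ`, `R₀ ≥ r + max 1 δ`), then the cluster carries the excess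
`#C · e* + m ε/2 ≤ (∑∑_C V_LJ)/2`.
Proof: perform all `m` modifications simultaneously inside `C`; the repaired cluster `C'` has
`#C + m(k − n₀)` DISTINCT points, so `#C' e* ≤ (∑∑_{C'} V)/2` (periodisation,
`card_mul_eStar_le`), while `∑∑_{C'} − ∑∑_C = 2 Σ_j gain_j + CROSS + TAIL` by the bilinear
expansion of `Cluster`, with `|CROSS| ≤ m ε/2` (far clusters, `sum_inv_pow_six_le_of_le_dist`)
and `|TAIL| ≤ m ε/2` (depth, `tsum_abs_lennardJones_le_of_far`).
-/

noncomputable section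

open MeasureTheory
open scoped ENNReal BigOperators

namespace Summit.AtomisticToContinuum.Crystallization.Theorems.PalmUnimodularRigidityMinimiserShells.EquilibriumInLaw.Repair

open Literature.Probability.Process (IsPointStationaryLaw IsRootedHardCore count_restrict_singleton_ne_zero_iff
  map_sub_count_restrict)
open Literature.MathematicalPhysics.StatisticalMechanics (lennardJones IsMuGSC UniformlyDiscrete)
open Summit.AtomisticToContinuum.Crystallization.Theses.PalmUnimodularRigidity (MinimiserShells UnimodularEnergyLowerBound)
open Summit.AtomisticToContinuum.Crystallization.Theorems.MinimiserShells.Negative.LoadBearing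
  (eStar meanRootEnergy GoodShell minimiserShells_iff)
open Literature.MathematicalPhysics.StatisticalMechanics (interactionEnergy fieldEnergy fieldEnergy_eq
  sum_inv_pow_six_le_of_le_dist)
open Summit.AtomisticToContinuum.Crystallization.Theorems.MinimiserShells.Negative.Rootedness (E3)
open Summit.AtomisticToContinuum.Crystallization.Theorems.PalmUnimodularRigidityMinimiserShells.EquilibriumInLaw.Cluster
  (two_mul_interactionEnergy_eq_sum_sum_image sum_eq_sum_image card_image_of_injective coe_image_univ
  card_mul_eStar_le_half_sum_sum sum_sum_union_biUnion abs_sum_sum_le_of_far abs_sum_tsum_sdiff_le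
  sum_tsum_sdiff_expand)

/-! ## The repair inequality -/

/-- **Multi-site cluster repair.** See the module docstring. The centres `y_j` need not belong
to `C`; only injectivity of the repaired cluster is used (no hard core for the inserted points). -/
theorem le_half_sum_sum_of_repairSites {δ : ℝ} (hδ : 0 < δ) {S : Set E3}
    (hsep : ∀ x ∈ S, ∀ z ∈ S, x ≠ z → δ ≤ dist x z) (C : Finset E3) (hCS : ↑C ⊆ S)
    {n₀ k m : ℕ} {r ε R₀ D : ℝ} (hr : 0 ≤ r) (hR₀ : r + max 1 δ ≤ R₀)
    (htail : 500 * (n₀ + k) * (δ⁻¹ ^ 4 * (R₀ - r)⁻¹ ^ 2) ≤ ε / 2)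
    (hD : 4 * r + max 1 δ ≤ D) (hcross : 4000 * (n₀ + k) ^ 2 * D⁻¹ ^ 6 ≤ ε / 2)
    (y : Fin m → E3) (xf : Fin m → Fin n₀ → E3) (R : Fin m → Fin k → E3)
    (hyD : ∀ j i, j ≠ i → D ≤ dist (y j) (y i))
    (hdeep : ∀ j, S ∩ Metric.closedBall (y j) R₀ ⊆ ↑C)
    (hxf : ∀ j, Function.Injective (xf j)) (hxfS : ∀ j, Set.range (xf j) ⊆ S)
    (hxfr : ∀ j l, dist (xf j l) (y j) ≤ r)
    (hRinj : ∀ j, Function.Injective (R j)) (hRr : ∀ j i, dist (R j i) (y j) ≤ r)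
    (hRdisj : ∀ j, Disjoint (Set.range (R j)) (S \ Set.range (xf j)))
    (hgain : ∀ j, interactionEnergy lennardJones (R j) +
        fieldEnergy lennardJones (R j) (S \ Set.range (xf j)) - eStar * k + ε ≤
      interactionEnergy lennardJones (xf j) +
        fieldEnergy lennardJones (xf j) (S \ Set.range (xf j)) - eStar * n₀) :
    (C.card : ℝ) * eStar + m * (ε / 2) ≤ (∑ x ∈ C, ∑ z ∈ C, lennardJones (dist x z)) / 2 := by
  -- the Finsets of the construction (kept opaque, with defining equations)
  obtain ⟨X, hX⟩ : ∃ X : Fin m → Finset E3, ∀ j, X j = Finset.univ.image (xf j) :=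
    ⟨_, fun _ => rfl⟩
  obtain ⟨Q, hQ⟩ : ∃ Q : Fin m → Finset E3, ∀ j, Q j = Finset.univ.image (R j) :=
    ⟨_, fun _ => rfl⟩
  obtain ⟨C₀, hC₀⟩ : ∃ C₀ : Finset E3, C₀ = C \ Finset.univ.biUnion X := ⟨_, rfl⟩
  have h1δ : 1 ≤ max 1 δ := le_max_left _ _
  have hD0 : 0 < D := by linarith
  -- membership facts
  have hXr : ∀ j, ∀ x ∈ X j, dist x (y j) ≤ r := by
    intro j x hx
    rw [hX j] at hx
    obtain ⟨l, -, rfl⟩ := Finset.mem_image.1 hx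
    exact hxfr j l
  have hQr : ∀ j, ∀ x ∈ Q j, dist x (y j) ≤ r := by
    intro j x hx
    rw [hQ j] at hx
    obtain ⟨i, -, rfl⟩ := Finset.mem_image.1 hx
    exact hRr j i
  have hXcoe : ∀ j, (↑(X j) : Set E3) = Set.range (xf j) := fun j => by
    rw [hX j]; exact coe_image_univ (xf j)
  have hQcoe : ∀ j, (↑(Q j) : Set E3) = Set.range (R j) := fun j => by
    rw [hQ j]; exact coe_image_univ (R j)
  have hXS : ∀ j, ∀ x ∈ X j, x ∈ S := fun j x hx =>
    hxfS j (by rw [← hXcoe j]; exact Finset.mem_coe.2 hx)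
  have hXC : ∀ j, X j ⊆ C := by
    intro j x hx
    have : x ∈ (↑C : Set E3) :=
      hdeep j ⟨hXS j x hx, Metric.mem_closedBall.2 (by linarith [hXr j x hx])⟩
    exact Finset.mem_coe.1 this
  -- two points near distinct centres are distinct
  have hfar : ∀ j i, j ≠ i → ∀ x z : E3, dist x (y j) ≤ r → dist z (y i) ≤ r → x ≠ z := by
    intro j i hji x z hx hz hxz
    subst hxz
    have h1 := dist_triangle (y j) x (y i)
    rw [dist_comm (y j) x] at h1
    have h2 := hyD j i hji
    linarith
  have hXdisj : ∀ j i, j ≠ i → Disjoint (X j) (X i) := fun j i hji =>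
    Finset.disjoint_left.2 fun x hxj hxi => hfar j i hji x x (hXr j x hxj) (hXr i x hxi) rfl
  have hQdisj : ∀ j i, j ≠ i → Disjoint (Q j) (Q i) := fun j i hji =>
    Finset.disjoint_left.2 fun x hxj hxi => hfar j i hji x x (hQr j x hxj) (hQr i x hxi) rfl
  -- `Q j` misses `C ∖ X j` (admissibility), hence `C₀`
  have hQC : ∀ j, ∀ x ∈ Q j, x ∉ C \ X j := by
    intro j x hxQ hxC
    have hx1 : x ∈ Set.range (R j) := by rw [← hQcoe j]; exact Finset.mem_coe.2 hxQ
    have hx2 : x ∈ S \ Set.range (xf j) := by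
      refine ⟨hCS (Finset.mem_coe.2 (Finset.mem_sdiff.1 hxC).1), fun h => ?_⟩
      rw [← hXcoe j] at h
      exact (Finset.mem_sdiff.1 hxC).2 (Finset.mem_coe.1 h)
    exact Set.disjoint_left.1 (hRdisj j) hx1 hx2
  have hC₀sub : ∀ j, C₀ ⊆ C \ X j := by
    intro j x hx
    rw [hC₀, Finset.mem_sdiff] at hx
    exact Finset.mem_sdiff.2
      ⟨hx.1, fun hxj => hx.2 (Finset.mem_biUnion.2 ⟨j, Finset.mem_univ j, hxj⟩)⟩
  have hQC₀ : ∀ j, Disjoint C₀ (Q j) := fun j =>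
    Finset.disjoint_left.2 fun x hx0 hxQ => hQC j x hxQ (hC₀sub j hx0)
  have hC₀X : ∀ j, Disjoint C₀ (X j) := fun j =>
    Finset.disjoint_left.2 fun x hx0 hxX => (Finset.mem_sdiff.1 (hC₀sub j hx0)).2 hxX
  -- cards
  have hXUC : Finset.univ.biUnion X ⊆ C := Finset.biUnion_subset.2 fun j _ => hXC j
  have hpdX : (↑(Finset.univ : Finset (Fin m)) : Set (Fin m)).PairwiseDisjoint X :=
    fun j _ i _ hji => hXdisj j i hji
  have hpdQ : (↑(Finset.univ : Finset (Fin m)) : Set (Fin m)).PairwiseDisjoint Q :=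
    fun j _ i _ hji => hQdisj j i hji
  have hcardX : ∀ j, (X j).card = n₀ := fun j => by
    rw [hX j]; exact card_image_of_injective (hxf j)
  have hcardQ : ∀ j, (Q j).card = k := fun j => by
    rw [hQ j]; exact card_image_of_injective (hRinj j)
  have hcardXU : (Finset.univ.biUnion X).card = m * n₀ := by
    rw [Finset.card_biUnion hpdX, Finset.sum_congr rfl fun j _ => hcardX j, Finset.sum_const,
      Finset.card_univ, Fintype.card_fin, smul_eq_mul]
  have hcardQU : (Finset.univ.biUnion Q).card = m * k := by
    rw [Finset.card_biUnion hpdQ, Finset.sum_congr rfl fun j _ => hcardQ j, Finset.sum_const,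
      Finset.card_univ, Fintype.card_fin, smul_eq_mul]
  have hCeq : C₀ ∪ Finset.univ.biUnion X = C := by
    rw [hC₀]; exact Finset.sdiff_union_of_subset hXUC
  have hC₀XU : Disjoint C₀ (Finset.univ.biUnion X) := by
    rw [hC₀]; exact Finset.sdiff_disjoint
  have hC₀QU : Disjoint C₀ (Finset.univ.biUnion Q) :=
    (Finset.disjoint_biUnion_right _ _ _).2 fun j _ => hQC₀ j
  have hcardC : (C.card : ℝ) = C₀.card + m * n₀ := by
    rw [← hCeq, Finset.card_union_of_disjoint hC₀XU, hcardXU]; push_cast; ring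
  have hcardC' : ((C₀ ∪ Finset.univ.biUnion Q).card : ℝ) = C₀.card + m * k := by
    rw [Finset.card_union_of_disjoint hC₀QU, hcardQU]; push_cast; ring
  -- periodisation for the repaired cluster
  have hper := card_mul_eStar_le_half_sum_sum (C₀ ∪ Finset.univ.biUnion Q)
  rw [hcardC'] at hper
  -- expansions of the two double sums
  have hsym : ∀ x z : E3, lennardJones (dist x z) = lennardJones (dist z x) := fun x z => by
    rw [dist_comm]
  have expC' := sum_sum_union_biUnion C₀ Q hQC₀ hQdisj (fun x z => lennardJones (dist x z)) hsym
  have expC := sum_sum_union_biUnion C₀ X hC₀X hXdisj (fun x z => lennardJones (dist x z)) hsym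
  rw [hCeq] at expC
  beta_reduce at expC expC'
  -- the gains, rewritten in cluster terms
  have gain2 : ∀ j,
      ∑ x ∈ Q j, ∑ z ∈ Q j, lennardJones (dist x z) +
        2 * (∑ x ∈ Q j, ∑ z ∈ C₀, lennardJones (dist x z) +
          ∑ i ∈ Finset.univ.erase j, ∑ x ∈ Q j, ∑ z ∈ X i, lennardJones (dist x z) +
          ∑ x ∈ Q j, ∑' z : ↥(S \ ↑C), lennardJones (dist x z)) - 2 * (eStar * k) + 2 * ε ≤
      ∑ x ∈ X j, ∑ z ∈ X j, lennardJones (dist x z) +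
        2 * (∑ x ∈ X j, ∑ z ∈ C₀, lennardJones (dist x z) +
          ∑ i ∈ Finset.univ.erase j, ∑ x ∈ X j, ∑ z ∈ X i, lennardJones (dist x z) +
          ∑ x ∈ X j, ∑' z : ↥(S \ ↑C), lennardJones (dist x z)) - 2 * (eStar * n₀) := by
    intro j
    have hg := hgain j
    rw [fieldEnergy_eq, fieldEnergy_eq, ← hXcoe j,
      sum_eq_sum_image (hRinj j) (fun x => ∑' z : ↥(S \ ↑(X j)), lennardJones (dist x z)),
      sum_eq_sum_image (hxf j) (fun x => ∑' z : ↥(S \ ↑(X j)), lennardJones (dist x z)),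
      ← hX j, ← hQ j,
      sum_tsum_sdiff_expand hδ hsep C hCS X hXC hXdisj C₀ hC₀ j (Q j),
      sum_tsum_sdiff_expand hδ hsep C hCS X hXC hXdisj C₀ hC₀ j (X j)] at hg
    have hU1 := two_mul_interactionEnergy_eq_sum_sum_image (hRinj j)
    have hU2 := two_mul_interactionEnergy_eq_sum_sum_image (hxf j)
    rw [← hQ j] at hU1
    rw [← hX j] at hU2
    linarith
  -- sum the gains over the sites
  have sumgain := Finset.sum_le_sum fun j (_ : j ∈ (Finset.univ : Finset (Fin m))) => gain2 j
  simp only [Finset.sum_add_distrib, Finset.sum_sub_distrib, ← Finset.mul_sum, Finset.sum_const,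
    Finset.card_univ, Fintype.card_fin, nsmul_eq_mul] at sumgain
  -- cross terms
  have hsumD : ∀ j, ∑ i ∈ Finset.univ.erase j, (dist (y j) (y i))⁻¹ ^ 6 ≤ 250 * D⁻¹ ^ 6 := by
    intro j
    have hinj : ∀ i ∈ Finset.univ.erase j, ∀ i' ∈ Finset.univ.erase j, y i = y i' → i = i' := by
      intro i _ i' _ h
      by_contra hne
      have := hyD i i' hne
      rw [h, dist_self] at this
      linarith
    rw [← Finset.sum_image (f := fun z => (dist (y j) z)⁻¹ ^ 6) hinj]
    refine sum_inv_pow_six_le_of_le_dist _ (y j) hD0 ?_ ?_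
    · intro z hz
      obtain ⟨i, hi, rfl⟩ := Finset.mem_image.1 hz
      exact hyD j i (Finset.ne_of_mem_erase hi).symm
    · intro z hz w hw hzw
      obtain ⟨i, -, rfl⟩ := Finset.mem_image.1 hz
      obtain ⟨i', -, rfl⟩ := Finset.mem_image.1 hw
      exact hyD i i' fun h => hzw (h ▸ rfl)
  have hcrossj : ∀ j, |∑ i ∈ Finset.univ.erase j,
      (∑ x ∈ Q j, ∑ z ∈ Q i, lennardJones (dist x z) -
        2 * ∑ x ∈ Q j, ∑ z ∈ X i, lennardJones (dist x z) +
        ∑ x ∈ X j, ∑ z ∈ X i, lennardJones (dist x z))| ≤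
      4000 * ((n₀ : ℝ) + k) ^ 2 * D⁻¹ ^ 6 := by
    intro j
    have hpair : ∀ i ∈ Finset.univ.erase j,
        |∑ x ∈ Q j, ∑ z ∈ Q i, lennardJones (dist x z) -
          2 * ∑ x ∈ Q j, ∑ z ∈ X i, lennardJones (dist x z) +
          ∑ x ∈ X j, ∑ z ∈ X i, lennardJones (dist x z)| ≤
        16 * ((n₀ : ℝ) + k) ^ 2 * (dist (y j) (y i))⁻¹ ^ 6 := by
      intro i hi
      have hji : j ≠ i := (Finset.ne_of_mem_erase hi).symm
      have hd := hyD j i hji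
      have hd1 : 2 * r + 1 ≤ dist (y j) (y i) := by linarith
      have hd2 : 4 * r ≤ dist (y j) (y i) := by linarith
      have b1 := abs_sum_sum_le_of_far (Q j) (Q i) (y j) (y i) (hQr j) (hQr i) hd1 hd2
      have b2 := abs_sum_sum_le_of_far (Q j) (X i) (y j) (y i) (hQr j) (hXr i) hd1 hd2
      have b3 := abs_sum_sum_le_of_far (X j) (X i) (y j) (y i) (hXr j) (hXr i) hd1 hd2
      rw [hcardQ j, hcardQ i] at b1
      rw [hcardQ j, hcardX i] at b2
      rw [hcardX j, hcardX i] at b3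
      calc |∑ x ∈ Q j, ∑ z ∈ Q i, lennardJones (dist x z) -
              2 * ∑ x ∈ Q j, ∑ z ∈ X i, lennardJones (dist x z) +
              ∑ x ∈ X j, ∑ z ∈ X i, lennardJones (dist x z)|
          ≤ |∑ x ∈ Q j, ∑ z ∈ Q i, lennardJones (dist x z) -
              2 * ∑ x ∈ Q j, ∑ z ∈ X i, lennardJones (dist x z)| +
              |∑ x ∈ X j, ∑ z ∈ X i, lennardJones (dist x z)| := abs_add_le _ _
        _ ≤ |∑ x ∈ Q j, ∑ z ∈ Q i, lennardJones (dist x z)| +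
              |2 * ∑ x ∈ Q j, ∑ z ∈ X i, lennardJones (dist x z)| +
              |∑ x ∈ X j, ∑ z ∈ X i, lennardJones (dist x z)| := by
            gcongr
            exact abs_sub _ _
        _ = |∑ x ∈ Q j, ∑ z ∈ Q i, lennardJones (dist x z)| +
              2 * |∑ x ∈ Q j, ∑ z ∈ X i, lennardJones (dist x z)| +
              |∑ x ∈ X j, ∑ z ∈ X i, lennardJones (dist x z)| := by
            rw [abs_mul, abs_two]
        _ ≤ (k : ℝ) * k * (16 * (dist (y j) (y i))⁻¹ ^ 6) +
              2 * ((k : ℝ) * n₀ * (16 * (dist (y j) (y i))⁻¹ ^ 6)) +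
              (n₀ : ℝ) * n₀ * (16 * (dist (y j) (y i))⁻¹ ^ 6) := by
            gcongr
        _ = 16 * ((n₀ : ℝ) + k) ^ 2 * (dist (y j) (y i))⁻¹ ^ 6 := by ring
    calc |∑ i ∈ Finset.univ.erase j,
          (∑ x ∈ Q j, ∑ z ∈ Q i, lennardJones (dist x z) -
            2 * ∑ x ∈ Q j, ∑ z ∈ X i, lennardJones (dist x z) +
            ∑ x ∈ X j, ∑ z ∈ X i, lennardJones (dist x z))|
        ≤ ∑ i ∈ Finset.univ.erase j,
          |∑ x ∈ Q j, ∑ z ∈ Q i, lennardJones (dist x z) -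
            2 * ∑ x ∈ Q j, ∑ z ∈ X i, lennardJones (dist x z) +
            ∑ x ∈ X j, ∑ z ∈ X i, lennardJones (dist x z)| := Finset.abs_sum_le_sum_abs _ _
      _ ≤ ∑ i ∈ Finset.univ.erase j, 16 * ((n₀ : ℝ) + k) ^ 2 * (dist (y j) (y i))⁻¹ ^ 6 :=
          Finset.sum_le_sum hpair
      _ = 16 * ((n₀ : ℝ) + k) ^ 2 * ∑ i ∈ Finset.univ.erase j, (dist (y j) (y i))⁻¹ ^ 6 := by
          rw [Finset.mul_sum]
      _ ≤ 16 * ((n₀ : ℝ) + k) ^ 2 * (250 * D⁻¹ ^ 6) :=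
          mul_le_mul_of_nonneg_left (hsumD j) (by positivity)
      _ = 4000 * ((n₀ : ℝ) + k) ^ 2 * D⁻¹ ^ 6 := by ring
  have hcross_tot : |∑ j, ∑ i ∈ Finset.univ.erase j,
      (∑ x ∈ Q j, ∑ z ∈ Q i, lennardJones (dist x z) -
        2 * ∑ x ∈ Q j, ∑ z ∈ X i, lennardJones (dist x z) +
        ∑ x ∈ X j, ∑ z ∈ X i, lennardJones (dist x z))| ≤ m * (ε / 2) := by
    calc |∑ j, ∑ i ∈ Finset.univ.erase j,
          (∑ x ∈ Q j, ∑ z ∈ Q i, lennardJones (dist x z) -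
            2 * ∑ x ∈ Q j, ∑ z ∈ X i, lennardJones (dist x z) +
            ∑ x ∈ X j, ∑ z ∈ X i, lennardJones (dist x z))|
        ≤ ∑ j, |∑ i ∈ Finset.univ.erase j,
          (∑ x ∈ Q j, ∑ z ∈ Q i, lennardJones (dist x z) -
            2 * ∑ x ∈ Q j, ∑ z ∈ X i, lennardJones (dist x z) +
            ∑ x ∈ X j, ∑ z ∈ X i, lennardJones (dist x z))| := Finset.abs_sum_le_sum_abs _ _
      _ ≤ ∑ _j : Fin m, 4000 * ((n₀ : ℝ) + k) ^ 2 * D⁻¹ ^ 6 :=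
          Finset.sum_le_sum fun j _ => hcrossj j
      _ = m * (4000 * ((n₀ : ℝ) + k) ^ 2 * D⁻¹ ^ 6) := by
          rw [Finset.sum_const, Finset.card_univ, Fintype.card_fin, nsmul_eq_mul]
      _ ≤ m * (ε / 2) := mul_le_mul_of_nonneg_left hcross (Nat.cast_nonneg m)
  -- tails
  have htailj : ∀ j, |∑ x ∈ X j, ∑' z : ↥(S \ ↑C), lennardJones (dist x z) -
      ∑ x ∈ Q j, ∑' z : ↥(S \ ↑C), lennardJones (dist x z)| ≤
      ((n₀ : ℝ) + k) * (250 * δ⁻¹ ^ 4 * (R₀ - r)⁻¹ ^ 2) := by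
    intro j
    have t1 := abs_sum_tsum_sdiff_le hδ hsep C (hdeep j) hR₀ (X j) (hXr j)
    have t2 := abs_sum_tsum_sdiff_le hδ hsep C (hdeep j) hR₀ (Q j) (hQr j)
    rw [hcardX j] at t1
    rw [hcardQ j] at t2
    calc |∑ x ∈ X j, ∑' z : ↥(S \ ↑C), lennardJones (dist x z) -
            ∑ x ∈ Q j, ∑' z : ↥(S \ ↑C), lennardJones (dist x z)|
        ≤ |∑ x ∈ X j, ∑' z : ↥(S \ ↑C), lennardJones (dist x z)| +
            |∑ x ∈ Q j, ∑' z : ↥(S \ ↑C), lennardJones (dist x z)| := abs_sub _ _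
      _ ≤ (n₀ : ℝ) * (250 * δ⁻¹ ^ 4 * (R₀ - r)⁻¹ ^ 2) +
            (k : ℝ) * (250 * δ⁻¹ ^ 4 * (R₀ - r)⁻¹ ^ 2) := add_le_add t1 t2
      _ = ((n₀ : ℝ) + k) * (250 * δ⁻¹ ^ 4 * (R₀ - r)⁻¹ ^ 2) := by ring
  have htail_tot : |∑ j, (∑ x ∈ X j, ∑' z : ↥(S \ ↑C), lennardJones (dist x z) -
      ∑ x ∈ Q j, ∑' z : ↥(S \ ↑C), lennardJones (dist x z))| ≤ m * (ε / 4) := by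
    calc |∑ j, (∑ x ∈ X j, ∑' z : ↥(S \ ↑C), lennardJones (dist x z) -
          ∑ x ∈ Q j, ∑' z : ↥(S \ ↑C), lennardJones (dist x z))|
        ≤ ∑ j, |∑ x ∈ X j, ∑' z : ↥(S \ ↑C), lennardJones (dist x z) -
          ∑ x ∈ Q j, ∑' z : ↥(S \ ↑C), lennardJones (dist x z)| := Finset.abs_sum_le_sum_abs _ _
      _ ≤ ∑ _j : Fin m, ((n₀ : ℝ) + k) * (250 * δ⁻¹ ^ 4 * (R₀ - r)⁻¹ ^ 2) :=
          Finset.sum_le_sum fun j _ => htailj j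
      _ = m * (((n₀ : ℝ) + k) * (250 * δ⁻¹ ^ 4 * (R₀ - r)⁻¹ ^ 2)) := by
          rw [Finset.sum_const, Finset.card_univ, Fintype.card_fin, nsmul_eq_mul]
      _ ≤ m * (ε / 4) := mul_le_mul_of_nonneg_left (by linarith) (Nat.cast_nonneg m)
  -- combine
  have hX1 := abs_le.1 hcross_tot
  have hX2 := abs_le.1 htail_tot
  rw [Finset.sum_sub_distrib] at hX2
  have hcross_split : ∑ j, ∑ i ∈ Finset.univ.erase j,
      (∑ x ∈ Q j, ∑ z ∈ Q i, lennardJones (dist x z) -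
        2 * ∑ x ∈ Q j, ∑ z ∈ X i, lennardJones (dist x z) +
        ∑ x ∈ X j, ∑ z ∈ X i, lennardJones (dist x z)) =
      ∑ j, ∑ i ∈ Finset.univ.erase j, ∑ x ∈ Q j, ∑ z ∈ Q i, lennardJones (dist x z) -
        2 * ∑ j, ∑ i ∈ Finset.univ.erase j, ∑ x ∈ Q j, ∑ z ∈ X i, lennardJones (dist x z) +
        ∑ j, ∑ i ∈ Finset.univ.erase j, ∑ x ∈ X j, ∑ z ∈ X i, lennardJones (dist x z) := by
    simp only [Finset.sum_add_distrib, Finset.sum_sub_distrib, Finset.mul_sum]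
  rw [hcross_split] at hX1
  obtain ⟨hX1a, hX1b⟩ := hX1
  obtain ⟨hX2a, hX2b⟩ := hX2
  rw [hcardC]
  linarith

/-- Registered stub marker (helper part 4/14 of `stub_equilibriumInLaw`, line `equilibrium-in-law-surgery`):
the multi-site cluster repair inequality `le_half_sum_sum_of_repairSites`, closed form. -/
theorem stub_equilibriumInLaw_part04 :
    ∀ (δ : ℝ), 0 < δ → ∀ (S : Set (EuclideanSpace ℝ (Fin 3))), (∀ x ∈ S, ∀ z ∈ S, x ≠ z → δ ≤ dist x z) →
      ∀ (C : Finset (EuclideanSpace ℝ (Fin 3))), (↑C : Set (EuclideanSpace ℝ (Fin 3))) ⊆ S →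
      ∀ (n₀ k m : ℕ) (r ε R₀ D : ℝ), 0 ≤ r → r + max 1 δ ≤ R₀ →
      500 * (n₀ + k) * (δ⁻¹ ^ 4 * (R₀ - r)⁻¹ ^ 2) ≤ ε / 2 → 4 * r + max 1 δ ≤ D →
      4000 * (n₀ + k) ^ 2 * D⁻¹ ^ 6 ≤ ε / 2 →
      ∀ (y : Fin m → EuclideanSpace ℝ (Fin 3)) (xf : Fin m → Fin n₀ → EuclideanSpace ℝ (Fin 3))
        (R : Fin m → Fin k → EuclideanSpace ℝ (Fin 3)),
      (∀ j i, j ≠ i → D ≤ dist (y j) (y i)) → (∀ j, S ∩ Metric.closedBall (y j) R₀ ⊆ ↑C) →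
      (∀ j, Function.Injective (xf j)) → (∀ j, Set.range (xf j) ⊆ S) → (∀ j l, dist (xf j l) (y j) ≤ r) →
      (∀ j, Function.Injective (R j)) → (∀ j i, dist (R j i) (y j) ≤ r) →
      (∀ j, Disjoint (Set.range (R j)) (S \ Set.range (xf j))) →
      (∀ j, interactionEnergy lennardJones (R j) + fieldEnergy lennardJones (R j) (S \ Set.range (xf j)) - eStar * k + ε ≤
        interactionEnergy lennardJones (xf j) + fieldEnergy lennardJones (xf j) (S \ Set.range (xf j)) - eStar * n₀) →
      (C.card : ℝ) * eStar + m * (ε / 2) ≤ (∑ x ∈ C, ∑ z ∈ C, lennardJones (dist x z)) / 2 :=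
  fun _ hδ _ hsep C hCS _ _ _ _ _ _ _ hr hR₀ htail hD hcross y xf R hyD hdeep hxf hxfS hxfr hRinj hRr hRdisj hgain =>
    le_half_sum_sum_of_repairSites hδ hsep C hCS hr hR₀ htail hD hcross y xf R hyD hdeep hxf hxfS hxfr hRinj hRr
      hRdisj hgain

end Summit.AtomisticToContinuum.Crystallization.Theorems.PalmUnimodularRigidityMinimiserShells.EquilibriumInLaw.Repair

end
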